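import Mathlib.Data.Nat.Pairing
import Literature.Computability.MetaComplexity.LanguageCompression
import Literature.Computability.MetaComplexity.DirectProductGenerator
import Literature.Computability.MetaComplexity.UPSearchBricks
import Literature.Computability.Cryptography.LiuPassLemma53Programs
import Literature.Computability.Complexity.LengthCompare
import Literature.Computability.Complexity.StringEquality
import Literature.Computability.Complexity.UniformProbBlocks
import HarnessLib

/-!
# Complexity meta: the `NP` language `L'` of the proof of Thm. 4.2 of Hirahara 2021 and its union bound

Topic `Literature/Computability/MetaComplexity`, part of the inline proof plan of
`Hirahara2021_languageCompression` (S. Hirahara, ECCC TR21-058 (2021), Thm. 4.2, proof on pp. 28–29).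
For an ensemble of languages `L = {L_t}` the printed proof introduces (p. 28)

> `L' = {(DP_k(x; z), 1^{⟨n,t⟩}) | x ∈ L_t ∩ {0,1}ⁿ, k = k(t)}`. Since `L ∈ NP`, one can observe that
> `L' ∈ NP`. (Indeed, `(w, 1^{⟨n,t⟩}) ∈ L'` if and only if there exist `x ∈ {0,1}ⁿ`, a certificate
> `y` for `x ∈ L_t`, and `z ∈ {0,1}^{n·k(t)}` such that `w = DP_{k(t)}(x; z)`.) … by a union bound,
> `Pr_w[(w, 1^{⟨n,t⟩}) ∈ L'] ≤ |L_t ∩ {0,1}ⁿ| · 2^{nk(t)} · 2^{-nk(t)-k(t)}` (Eq. (6)).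

This file vendors `L'` with the direct-product parameter `k` carried IN the index (`⟨n, k, t⟩` instead
of `⟨n, t⟩` with `k = k(t)`), so that `L'` is one fixed `NP` language, defined before `k(t)` is chosen
(the choice of `k(t)` in the assembly depends on the heuristic obtained for `L'`); the slices used by
the proof are those at `k = k(t)`:

* `idx3 n k t = ⟨n, ⟨k, t⟩⟩` (Mathlib `Nat.pair`, nested), `idx3UF` its unary brick;
* `dpLang L = {(DP_k(x; z), 1^{⟨n,k,t⟩}) | x ∈ L_t ∩ {0,1}ⁿ, z ∈ {0,1}^{nk}}`,
  `paramEnc_mem_dpLang_iff` (the slices);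
* `dpLang_mem_NP` — **`L ∈ NP ⟹ L' ∈ NP`** (certificate `⟨1ᵏ, ⟨1ᵗ, ⟨x, ⟨z, y⟩⟩⟩⟩`, verifier `DPNP.verF`,
  an `andFn` chain of the tree's one-bit bricks as in `UPSearchNP.lean`, with `Cryptography.L53Prog.glFn`
  computing the Hadamard bits of `DP_k`);
* `uniformProb_dpLang_slice_le` — **Eq. (6)**: `Pr_{w ← {0,1}^{nk+k}}[(w, 1^{⟨n,k,t⟩}) ∈ L'] ≤
  |L_t ∩ {0,1}ⁿ| / 2^k` (for an ensemble; union bound over `x`, each `DP_k(x; ·)` being injective).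

## References

* S. Hirahara, ECCC TR21-058 (2021), proof of Thm. 4.2 (p. 28: `L'`, "`L' ∈ NP`", Eq. (6)), Def. 3.10,
  Def. 4.1 [Hirahara2021].
* S. Arora, B. Barak, *Computational Complexity: A Modern Approach*, CUP 2009, Def. 2.1 [AroraBarakCC2009].
-/

noncomputable section

namespace Literature.Computability.MetaComplexity

open _root_.Computability Polynomial Complexity Complexity.Classes Complexity.Nondeterministic Complexity.Brick
  Complexity.Plumb Complexity.HashBricks Complexity.LenCmp Cryptography Finset

/-! ### The index `⟨n, k, t⟩` -/

/-- The index `⟨n, k, t⟩ = pair n (pair k t)` of the slices of `L'`. [folklore] -/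
def idx3 (n k t : ℕ) : ℕ := Nat.pair n (Nat.pair k t)

/-- The index coding is injective. [folklore] -/
theorem idx3_injective {n k t n' k' t' : ℕ} (h : idx3 n k t = idx3 n' k' t') : n = n' ∧ k = k' ∧ t = t' := by
  unfold idx3 at h
  have h1 := congr_arg Nat.unpair h
  simp only [Nat.unpair_pair, Prod.mk.injEq] at h1
  have h2 := congr_arg Nat.unpair h1.2
  simp only [Nat.unpair_pair, Prod.mk.injEq] at h2
  exact ⟨h1.1, h2.1, h2.2⟩

/-- The components are bounded by the index. [folklore] -/
theorem le_idx3 (n k t : ℕ) : n ≤ idx3 n k t ∧ k ≤ idx3 n k t ∧ t ≤ idx3 n k t :=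
  ⟨Nat.left_le_pair _ _, (Nat.left_le_pair _ _).trans (Nat.right_le_pair _ _),
    (Nat.right_le_pair _ _).trans (Nat.right_le_pair _ _)⟩

/-- `(n+1) k ≤ ⟨n, k, t⟩ · (⟨n, k, t⟩ + 1)`: the sample length is polynomial in the index. [folklore] -/
theorem succ_mul_le_idx3 (n k t : ℕ) : (n + 1) * k ≤ (idx3 n k t + 1) * idx3 n k t := by
  obtain ⟨hn, hk, -⟩ := le_idx3 n k t
  exact Nat.mul_le_mul (by omega) hk

/-- **`idx3UF ⟨1ⁿ, ⟨1ᵏ, 1ᵗ⟩⟩ = 1^{⟨n,k,t⟩}`** (the tree's `pairUF`, nested). [folklore] -/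
def idx3UF : List Bool → List Bool := pairUF ∘ fanoutFn (nthF 0) (pairUF ∘ fanoutFn (nthF 1) (sndPow 1))

/-- Semantics of `idx3UF`. [folklore] -/
@[simp] theorem idx3UF_apply (n k t : ℕ) :
    idx3UF (boolPair (ones n) (boolPair (ones k) (ones t))) = ones (idx3 n k t) := by
  simp [idx3UF, fanoutFn_apply, idx3]

/-- `idx3UF ∈ FP`. [folklore] -/
theorem idx3UF_mem_FP : idx3UF ∈ FP :=
  comp_mem_FP pairUF_mem_FP (fanoutFn_mem_FP (nthF_mem_FP 0) (comp_mem_FP pairUF_mem_FP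
    (fanoutFn_mem_FP (nthF_mem_FP 1) (sndPow_mem_FP 1))))

/-! ### The language `L'` -/

/-- **The language `L'` of the proof of Thm. 4.2**, with the direct-product parameter in the index:
`{(DP_k(x; z), 1^{⟨n,k,t⟩}) | x ∈ L_t ∩ {0,1}ⁿ, z ∈ {0,1}^{nk}}`.
[cite: Hirahara2021, Thm. 4.2 (proof, p. 28: the language L')] -/
def dpLang (L : Language Bool) : Language Bool :=
  {v | ∃ (n k t : ℕ) (x z : List Bool), v = paramEnc (dpGen k x z, idx3 n k t) ∧
    x.length = n ∧ z.length = n * k ∧ x ∈ languageSlice L t}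

/-- **The slices of `L'`**: `(w, 1^{⟨n,k,t⟩}) ∈ L'` iff `w = DP_k(x; z)` for some `x ∈ L_t ∩ {0,1}ⁿ` and
`z ∈ {0,1}^{nk}`. [cite: Hirahara2021, Thm. 4.2 (proof, p. 28)] -/
theorem paramEnc_mem_dpLang_iff (L : Language Bool) (w : List Bool) (n k t : ℕ) :
    paramEnc (w, idx3 n k t) ∈ dpLang L ↔
      ∃ x z : List Bool, x.length = n ∧ z.length = n * k ∧ x ∈ languageSlice L t ∧ w = dpGen k x z := by
  constructor
  · rintro ⟨n', k', t', x, z, h, hx, hz, hmem⟩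
    have h1 := boolPair_injective (a₁ := (w, _)) (a₂ := (dpGen k' x z, _)) h
    simp only [Prod.mk.injEq] at h1
    obtain ⟨rfl, h2⟩ := h1
    have hι : idx3 n k t = idx3 n' k' t' := by simpa using congr_arg unaryDecodeNat h2
    obtain ⟨rfl, rfl, rfl⟩ := idx3_injective hι
    exact ⟨x, z, hx, hz, hmem, rfl⟩
  · rintro ⟨x, z, hx, hz, hmem, rfl⟩
    exact ⟨n, k, t, x, z, rfl, hx, hz, hmem⟩

/-! ### `L' ∈ NP`: the certificate and the verifier -/

/-- The certificate `⟨1ᵏ, ⟨1ᵗ, ⟨x, ⟨z, y⟩⟩⟩⟩` (`y` a certificate of `(x, 1ᵗ) ∈ L`). [folklore] -/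
def dpCert (k t : ℕ) (x z y : List Bool) : List Bool :=
  boolPair (ones k) (boolPair (ones t) (boolPair x (boolPair z y)))

namespace DPNP

/-- `w` from `⟨⟨w, 1^ι⟩, cert⟩`. [folklore] -/
def wF : List Bool → List Bool := fstF ∘ fstF
/-- `1^ι`, normalised. [folklore] -/
def uiF : List Bool → List Bool := onesFn ∘ sndF ∘ fstF
/-- `1ᵏ`, normalised. [folklore] -/
def ukF : List Bool → List Bool := onesFn ∘ nthF 0 ∘ sndF
/-- `1ᵗ`, normalised. [folklore] -/
def utF : List Bool → List Bool := onesFn ∘ nthF 1 ∘ sndF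
/-- `x`. [folklore] -/
def xF : List Bool → List Bool := nthF 2 ∘ sndF
/-- `z`. [folklore] -/
def zF : List Bool → List Bool := nthF 3 ∘ sndF
/-- `y`. [folklore] -/
def yF : List Bool → List Bool := sndPow 3 ∘ sndF
/-- `DP_k(x; z) = z ‖ glBits k |x| x z`. [folklore] -/
def dpF : List Bool → List Bool :=
  fun π => zF π ++ (L53Prog.glFn ∘ fanoutFn (fanoutFn ukF (onesFn ∘ xF)) (fanoutFn xF zF)) π
/-- The instance `(x, 1ᵗ)` of `L`. [folklore] -/
def instF : List Bool → List Bool := fanoutFn xF utF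

variable (rTest : List Bool → List Bool) (pL : Polynomial ℕ)

/-- **The verifier** of `L'`, a one-bit string function on `⟨⟨w, 1^ι⟩, cert⟩`: the conjunction of
(0) the instance is well-formed, (1) `ι = ⟨|x|, k, t⟩`, (2) `w = DP_k(x; z)`, (3) `|z| = |x|·k`,
(4) `|y| ≤ p_L(|(x, 1ᵗ)|)`, (5) `⟨(x, 1ᵗ), y⟩ ∈ R_L`. [cite: Hirahara2021, Thm. 4.2 (proof, "L' ∈ NP")] -/
def verF : List Bool → List Bool :=
  andFn (eqPairFn ∘ fanoutFn (fanoutFn wF uiF) fstF)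
  (andFn (eqPairFn ∘ fanoutFn uiF (idx3UF ∘ fanoutFn (onesFn ∘ xF) (fanoutFn ukF utF)))
  (andFn (eqPairFn ∘ fanoutFn wF dpF)
  (andFn (eqPairFn ∘ fanoutFn (onesFn ∘ zF) (umulFn ∘ fanoutFn (onesFn ∘ xF) ukF))
  (andFn (lenLeFn pL ∘ fanoutFn instF yF)
    (rTest ∘ fanoutFn instF yF)))))

variable {rTest pL}

/-- **Semantics of the verifier** on `⟨⟨w, 1^ι⟩, c⟩` for an arbitrary certificate string, in terms of
its fields `k = |c₀|, t = |c₁|, x = c₂, z = c₃, y = c₄₊`. [folklore] -/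
theorem verF_apply {R : Language Bool} (hr : ∀ v, rTest v = [R.boolIndicator v]) (w : List Bool) (ι : ℕ)
    (c : List Bool) :
    verF rTest pL (boolPair (paramEnc (w, ι)) c) = [true] ↔
      (ι = idx3 (nthF 2 c).length (nthF 0 c).length (nthF 1 c).length ∧
       w = dpGen (nthF 0 c).length (nthF 2 c) (nthF 3 c) ∧
       (nthF 3 c).length = (nthF 2 c).length * (nthF 0 c).length ∧
       (sndPow 3 c).length ≤ pL.eval (paramEnc (nthF 2 c, (nthF 1 c).length)).length ∧
       boolPair (paramEnc (nthF 2 c, (nthF 1 c).length)) (sndPow 3 c) ∈ R) := by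
  set k := (nthF 0 c).length
  set t := (nthF 1 c).length
  set x := nthF 2 c
  set z := nthF 3 c
  set y := sndPow 3 c
  set π := boolPair (paramEnc (w, ι)) c with hπ
  have hlen : ∀ m, (ones m).length = m := fun m => by simp [ones]
  have hones : ∀ m, unaryEncodeNat m = ones m := Complexity.unaryEncodeNat_eq_replicate
  -- field values
  have hfst : fstF π = paramEnc (w, ι) := by simp [hπ]
  have hw : wF π = w := by simp [wF, hπ, paramEnc]
  have hui : uiF π = ones ι := by simp [uiF, hπ, paramEnc, onesFn, hones]
  have huk : ukF π = ones k := by simp [ukF, hπ, onesFn, hones, k]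
  have hut : utF π = ones t := by simp [utF, hπ, onesFn, hones, t]
  have hx : xF π = x := by simp [xF, hπ, x]
  have hz : zF π = z := by simp [zF, hπ, z]
  have hy : yF π = y := by simp [yF, hπ, y]
  have hxo : (onesFn ∘ xF) π = ones x.length := by simp [hx, onesFn, hones]
  have hinst : instF π = paramEnc (x, t) := by
    rw [instF, fanoutFn_apply, hx, hut, paramEnc, hones]
  have hdp : dpF π = dpGen k x z := by
    simp only [dpF, Function.comp_apply, fanoutFn_apply, hz, huk, hx]
    rw [show onesFn x = ones x.length by simp [onesFn, hones], L53Prog.glFn_boolPair]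
    rfl
  -- the six conditions
  have c0 : (eqPairFn ∘ fanoutFn (fanoutFn wF uiF) fstF) π = [true] := by
    rw [Function.comp_apply, fanoutFn_apply, fanoutFn_apply, hw, hui, hfst, eqPairFn_boolPair, paramEnc,
      hones, decide_eq_true rfl]
  have c1 : (eqPairFn ∘ fanoutFn uiF (idx3UF ∘ fanoutFn (onesFn ∘ xF) (fanoutFn ukF utF))) π =
      [decide (ι = idx3 x.length k t)] := by
    rw [Function.comp_apply, fanoutFn_apply, Function.comp_apply, fanoutFn_apply, fanoutFn_apply,
      hui, hxo, huk, hut, idx3UF_apply, eqPairFn_boolPair, Bool.decide_congr List.replicate_left_inj]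
  have c2 : (eqPairFn ∘ fanoutFn wF dpF) π = [decide (w = dpGen k x z)] := by
    rw [Function.comp_apply, fanoutFn_apply, hw, hdp, eqPairFn_boolPair]
  have c3 : (eqPairFn ∘ fanoutFn (onesFn ∘ zF) (umulFn ∘ fanoutFn (onesFn ∘ xF) ukF)) π =
      [decide (z.length = x.length * k)] := by
    rw [Function.comp_apply, fanoutFn_apply, Function.comp_apply, Function.comp_apply, fanoutFn_apply, hxo,
      hz, huk, umulFn_boolPair, eqPairFn_boolPair, show onesFn z = ones z.length by simp [onesFn, hones],
      Bool.decide_congr List.replicate_left_inj]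
  have c4 : (lenLeFn pL ∘ fanoutFn instF yF) π = [decide (y.length ≤ pL.eval (paramEnc (x, t)).length)] := by
    rw [Function.comp_apply, fanoutFn_apply, hinst, hy, lenLeFn_boolPair]
  have c5 : (rTest ∘ fanoutFn instF yF) π = [R.boolIndicator (boolPair (paramEnc (x, t)) y)] := by
    rw [Function.comp_apply, fanoutFn_apply, hinst, hy, hr]
  unfold verF
  rw [andFn_apply c0 (andFn_apply c1 (andFn_apply c2 (andFn_apply c3 (andFn_apply c4 c5))))]
  simp only [List.cons.injEq, and_true, Bool.true_and, Bool.and_eq_true, decide_eq_true_eq]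
  rw [← Set.mem_iff_boolIndicator]
  exact Iff.rfl

/-- **Soundness on arbitrary inputs**: if the verifier accepts `⟨v, c⟩` then `v` is a well-formed
instance `⟨w, 1^ι⟩` (condition (0) re-encodes and compares). [folklore] -/
theorem eq_paramEnc_of_verF (v c : List Bool) (h : verF rTest pL (boolPair v c) = [true]) :
    v = paramEnc (fstF v, (sndF v).length) := by
  have h0 : (eqPairFn ∘ fanoutFn (fanoutFn wF uiF) fstF) (boolPair v c) = [true] := by
    unfold verF at h
    obtain ⟨b, hb⟩ : ∃ b, (eqPairFn ∘ fanoutFn (fanoutFn wF uiF) fstF) (boolPair v c) = [b] := by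
      rcases eqPairFn_eq_or (fanoutFn (fanoutFn wF uiF) fstF (boolPair v c)) with h' | h' <;> exact ⟨_, h'⟩
    rw [andFn, iteFn_apply hb] at h
    cases b with
    | true => exact hb
    | false => simp at h
  rw [Function.comp_apply, fanoutFn_apply, fanoutFn_apply, fstF_boolPair, eqPairFn_boolPair] at h0
  simp only [wF, uiF, Function.comp_apply, fstF_boolPair, List.cons.injEq, and_true, decide_eq_true_eq] at h0
  rw [onesFn] at h0
  exact h0.symm

/-- The verifier is one-bit. [folklore] -/
theorem oneBit_verF (hr : OneBit rTest) : OneBit (verF rTest pL) := by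
  have he : ∀ f : List Bool → List Bool, OneBit (eqPairFn ∘ f) := fun f z => by
    rcases eqPairFn_eq_or (f z) with h | h <;> exact ⟨_, h⟩
  have hl : ∀ (q : Polynomial ℕ) (f : List Bool → List Bool), OneBit (lenLeFn q ∘ f) := fun q f z => by
    rcases lenLeFn_eq_or q (f z) with h | h <;> exact ⟨_, h⟩
  unfold verF
  exact oneBit_andFn (he _) (oneBit_andFn (he _) (oneBit_andFn (he _) (oneBit_andFn (he _)
    (oneBit_andFn (hl _ _) (hr.comp _)))))

/-- **The verifier is polynomial-time** (`FP`) when the membership test of `R_L` is.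
[cite: Hirahara2021, Thm. 4.2 (proof, "L' ∈ NP")] -/
theorem verF_mem_FP (hr : rTest ∈ FP) : verF rTest pL ∈ FP := by
  have hw : wF ∈ FP := comp_mem_FP fstF_mem_FP fstF_mem_FP
  have hui : uiF ∈ FP := comp_mem_FP onesFn_mem_FP (comp_mem_FP sndF_mem_FP fstF_mem_FP)
  have huk : ukF ∈ FP := comp_mem_FP onesFn_mem_FP (comp_mem_FP (nthF_mem_FP 0) sndF_mem_FP)
  have hut : utF ∈ FP := comp_mem_FP onesFn_mem_FP (comp_mem_FP (nthF_mem_FP 1) sndF_mem_FP)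
  have hx : xF ∈ FP := comp_mem_FP (nthF_mem_FP 2) sndF_mem_FP
  have hz : zF ∈ FP := comp_mem_FP (nthF_mem_FP 3) sndF_mem_FP
  have hy : yF ∈ FP := comp_mem_FP (sndPow_mem_FP 3) sndF_mem_FP
  have hxo : onesFn ∘ xF ∈ FP := comp_mem_FP onesFn_mem_FP hx
  have hinst : instF ∈ FP := fanoutFn_mem_FP hx hut
  have hdp : dpF ∈ FP := by
    unfold dpF
    exact append_mem_FP hz (comp_mem_FP L53Prog.glFn_mem_FP
      (fanoutFn_mem_FP (fanoutFn_mem_FP huk hxo) (fanoutFn_mem_FP hx hz)))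
  unfold verF
  exact andFn_mem_FP (comp_mem_FP eqPairFn_mem_FP (fanoutFn_mem_FP (fanoutFn_mem_FP hw hui) fstF_mem_FP))
    (andFn_mem_FP (comp_mem_FP eqPairFn_mem_FP (fanoutFn_mem_FP hui (comp_mem_FP idx3UF_mem_FP
      (fanoutFn_mem_FP hxo (fanoutFn_mem_FP huk hut)))))
    (andFn_mem_FP (comp_mem_FP eqPairFn_mem_FP (fanoutFn_mem_FP hw hdp))
    (andFn_mem_FP (comp_mem_FP eqPairFn_mem_FP (fanoutFn_mem_FP (comp_mem_FP onesFn_mem_FP hz)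
      (comp_mem_FP umulFn_mem_FP (fanoutFn_mem_FP hxo huk))))
    (andFn_mem_FP (comp_mem_FP (lenLeFn_mem_FP pL) (fanoutFn_mem_FP hinst hy))
      (comp_mem_FP hr (fanoutFn_mem_FP hinst hy))))))

end DPNP

open DPNP

/-- The certificate is polynomially short: `|⟨1ᵏ, ⟨1ᵗ, ⟨x, ⟨z, y⟩⟩⟩⟩| ≤ (p_L + 2)(3ι + 2)² + …` in terms of
the instance length (`k, t, n ≤ ι ≤ |(w, 1^ι)|`). [folklore] -/
theorem length_dpCert_le (pL : Polynomial ℕ) {n k t : ℕ} {x z y w : List Bool}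
    (hx : x.length = n) (hz : z.length = n * k) (hy : y.length ≤ pL.eval (paramEnc (x, t)).length) :
    (dpCert k t x z y).length ≤
      (2 * (X * X) + 6 * X + 8 + pL.comp (3 * X + 2) : Polynomial ℕ).eval (paramEnc (w, idx3 n k t)).length := by
  obtain ⟨hn, hk, ht⟩ := le_idx3 n k t
  have hones : ∀ m, (unaryEncodeNat m).length = m := unary_decode_encode_nat
  have hι : idx3 n k t ≤ (paramEnc (w, idx3 n k t)).length := by
    simp only [paramEnc, length_boolPair, hones]; omega
  have hxt : (paramEnc (x, t)).length ≤ 3 * (paramEnc (w, idx3 n k t)).length + 2 := by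
    simp only [paramEnc, length_boolPair, hones, hx]; omega
  have hy' : y.length ≤ pL.eval (3 * (paramEnc (w, idx3 n k t)).length + 2) := hy.trans (TM2Iter.eval_mono pL hxt)
  have hzL : z.length ≤ (paramEnc (w, idx3 n k t)).length * (paramEnc (w, idx3 n k t)).length := by
    rw [hz]; exact Nat.mul_le_mul (hn.trans hι) (hk.trans hι)
  simp only [dpCert, length_boolPair, eval_add, eval_mul, eval_X, eval_ofNat, eval_comp, ones, List.length_replicate, hx]
  omega

/-- **`L' ∈ NP`** for an `NP` ensemble `L`: certificate `⟨1ᵏ, ⟨1ᵗ, ⟨x, ⟨z, y⟩⟩⟩⟩`, verifier `DPNP.verF`.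
[cite: Hirahara2021, Thm. 4.2 (proof, p. 28: "one can observe that L' ∈ NP")] -/
theorem dpLang_mem_NP {L : Language Bool} (hL : L ∈ NP) : dpLang L ∈ NP := by
  obtain ⟨R, hR, pL, hLR⟩ := hL
  obtain ⟨r, Mach, hMach⟩ := polyTimeDecidable_iff.1 (mem_P_iff_holds.1 hR)
  have hdec : (fun z : List Bool => encodeBool (R.boolIndicator z)) ∈ FP := ⟨r, Mach, fun z => hMach z⟩
  set rTest : List Bool → List Bool := fun z => encodeBool (R.boolIndicator z) with hrT
  have hr : ∀ v, rTest v = [R.boolIndicator v] := fun v => rfl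
  set R' : Language Bool := {π | verF rTest pL π = [true]} with hR'
  have hone : OneBit (verF rTest pL) := oneBit_verF fun z => ⟨_, rfl⟩
  have hR'P : R' ∈ Classes.P := by
    refine mem_P_of_mem_FP (verF_mem_FP hdec) R' fun w => ⟨fun hw => hw, fun hw => ?_⟩
    obtain ⟨b, hb⟩ := hone w
    cases b with
    | true => exact absurd hb hw
    | false => exact hb
  refine ⟨R', hR'P, 2 * (X * X) + 6 * X + 8 + pL.comp (3 * X + 2), fun v => ⟨fun hv => ?_, fun hv => ?_⟩⟩
  · -- completeness
    obtain ⟨n, k, t, x, z, rfl, hx, hz, hmem⟩ := hv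
    obtain ⟨y, hy, hRy⟩ := (hLR _).1 (mem_languageSlice_iff.1 hmem)
    refine ⟨dpCert k t x z y, length_dpCert_le pL hx hz hy, ?_⟩
    change verF rTest pL (boolPair (paramEnc (_, idx3 n k t)) (dpCert k t x z y)) = [true]
    rw [verF_apply hr]
    have hlen : ∀ m, (ones m).length = m := fun m => by simp [ones]
    have e0 : nthF 0 (dpCert k t x z y) = ones k := by simp [dpCert]
    have e1 : nthF 1 (dpCert k t x z y) = ones t := by simp [dpCert]
    have e2 : nthF 2 (dpCert k t x z y) = x := by simp [dpCert]
    have e3 : nthF 3 (dpCert k t x z y) = z := by simp [dpCert]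
    have e4 : sndPow 3 (dpCert k t x z y) = y := by simp [dpCert]
    rw [e0, e1, e2, e3, e4, hlen, hlen, hx]
    exact ⟨rfl, rfl, hz, hy, hRy⟩
  · -- soundness
    obtain ⟨c, -, hc⟩ := hv
    have hc0 : verF rTest pL (boolPair v c) = [true] := hc
    have hv' := eq_paramEnc_of_verF v c hc0
    rw [hv'] at hc0 ⊢
    rw [verF_apply hr] at hc0
    obtain ⟨hι, hw, hz, hylen, hyR⟩ := hc0
    refine ⟨_, _, _, nthF 2 c, nthF 3 c, by rw [hι, hw], rfl, hz, ?_⟩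
    exact mem_languageSlice_iff.2 ((hLR _).2 ⟨sndPow 3 c, hylen, hyR⟩)

/-! ### Eq. (6): the union bound on a slice -/

/-- The strings of length `nk + k` of the form `DP_k(x; z)`, `z ∈ {0,1}^{nk}`, for ONE `x ∈ {0,1}ⁿ`, are
at most `2^{nk}` in number (`DP_k(x; ·)` is injective: the seed is a prefix). [cite: Hirahara2021, Def. 3.10] -/
theorem cnt_setOf_dpGen_le (k : ℕ) (x : List Bool) :
    cnt (x.length * k + k) {w | ∃ z : List Bool, z.length = x.length * k ∧ w = dpGen k x z} ≤ 2 ^ (x.length * k) := by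
  classical
  set M := x.length * k with hM
  unfold cnt
  have hcard : (univ : Finset (List.Vector Bool M)).card = 2 ^ M := by simp [card_vector]
  rw [← hcard]
  refine Finset.card_le_card_of_injOn (fun w => ⟨w.toList.take M, by
      rw [List.length_take, List.Vector.toList_length, Nat.min_eq_left (Nat.le_add_right M k)]⟩)
    (fun _ _ => mem_univ _) ?_
  intro w₁ hw₁ w₂ hw₂ h
  simp only [coe_filter, mem_univ, true_and, Set.mem_setOf_eq] at hw₁ hw₂
  obtain ⟨z₁, hz₁, h₁⟩ := hw₁
  obtain ⟨z₂, hz₂, h₂⟩ := hw₂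
  have ht₁ : w₁.toList.take M = z₁ := by rw [h₁, ← hz₁, take_length_dpGen]
  have ht₂ : w₂.toList.take M = z₂ := by rw [h₂, ← hz₂, take_length_dpGen]
  have hz : z₁ = z₂ := by
    have := congr_arg List.Vector.toList h
    simpa [ht₁, ht₂] using this
  apply List.Vector.toList_injective
  rw [h₁, h₂, hz]

/-- **Eq. (6), the union bound**: for an ensemble of languages `L`,
`Pr_{w ← {0,1}^{nk+k}}[(w, 1^{⟨n,k,t⟩}) ∈ L'] ≤ |L_t ∩ {0,1}ⁿ| · 2^{nk} · 2^{-nk-k} = |L_t ∩ {0,1}ⁿ| / 2^k`.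
[cite: Hirahara2021, Thm. 4.2 (proof, Eq. (6))] -/
theorem uniformProb_dpLang_slice_le {L : Language Bool} (hens : IsLanguageEnsemble L) (n k t : ℕ) :
    uniformProb (n * k + k) {w | paramEnc (w, idx3 n k t) ∈ dpLang L} ≤
      ((languageSlice L t ∩ {x | x.length = n}).ncard : ℝ) / 2 ^ k := by
  classical
  have hfin : (languageSlice L t ∩ {x : List Bool | x.length = n}).Finite :=
    (hens.finite_languageSlice t).subset Set.inter_subset_left
  set S := hfin.toFinset with hS
  have hsub : {w | paramEnc (w, idx3 n k t) ∈ dpLang L} ⊆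
      ⋃ x ∈ S, {w | ∃ z : List Bool, z.length = x.length * k ∧ w = dpGen k x z} := by
    intro w hw
    obtain ⟨x, z, hx, hz, hmem, rfl⟩ := (paramEnc_mem_dpLang_iff L w n k t).1 hw
    simp only [Set.mem_iUnion, Set.mem_setOf_eq, exists_prop]
    exact ⟨x, by rw [hS, Set.Finite.mem_toFinset]; exact ⟨hmem, hx⟩, z, by rw [hx, hz], rfl⟩
  have hcnt : cnt (n * k + k) {w | paramEnc (w, idx3 n k t) ∈ dpLang L} ≤
      cnt (n * k + k) (⋃ x ∈ S, {w | ∃ z : List Bool, z.length = x.length * k ∧ w = dpGen k x z}) := by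
    unfold cnt
    exact card_le_card fun r hr => by
      simp only [mem_filter, mem_univ, true_and] at hr ⊢
      exact hsub hr
  have hmono : uniformProb (n * k + k) {w | paramEnc (w, idx3 n k t) ∈ dpLang L} ≤
      uniformProb (n * k + k) (⋃ x ∈ S, {w | ∃ z : List Bool, z.length = x.length * k ∧ w = dpGen k x z}) := by
    rw [uniformProb_eq_cnt_div, uniformProb_eq_cnt_div]
    exact div_le_div_of_nonneg_right (by exact_mod_cast hcnt) (by positivity)
  refine hmono.trans ((uniformProb_biUnion_le _ S _).trans ?_)
  have hx : ∀ x ∈ S, uniformProb (n * k + k) {w | ∃ z : List Bool, z.length = x.length * k ∧ w = dpGen k x z} ≤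
      1 / 2 ^ k := by
    intro x hxS
    have hxn : x.length = n := by
      rw [hS, Set.Finite.mem_toFinset] at hxS
      exact hxS.2
    have h := cnt_setOf_dpGen_le k x
    rw [hxn] at h
    rw [uniformProb_eq_cnt_div, hxn, div_le_div_iff₀ (by positivity) (by positivity), pow_add, one_mul]
    have h' : ((cnt (n * k + k) {w | ∃ z : List Bool, z.length = n * k ∧ w = dpGen k x z} : ℕ) : ℝ) ≤ 2 ^ (n * k) := by
      exact_mod_cast h
    nlinarith [h', show (0 : ℝ) < 2 ^ k by positivity]
  calc (∑ x ∈ S, uniformProb (n * k + k) {w | ∃ z : List Bool, z.length = x.length * k ∧ w = dpGen k x z})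
      ≤ ∑ _x ∈ S, (1 : ℝ) / 2 ^ k := Finset.sum_le_sum hx
    _ = (S.card : ℝ) / 2 ^ k := by rw [Finset.sum_const, nsmul_eq_mul, mul_one_div]
    _ = ((languageSlice L t ∩ {x | x.length = n}).ncard : ℝ) / 2 ^ k := by
      rw [hS, Set.ncard_eq_toFinset_card _ hfin]

end Literature.Computability.MetaComplexity
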